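import Summits.Ventures.PercRepro.PurePairGraphTablesM
import Summits.Ventures.PercRepro.StarGadgetGraphReachCount
import Summits.Ventures.PercRepro.HWalkCentral

/-!
# The pure-pair gadget — the pair's tables, the avoided sets, and reachability (modules 3c + 4)

`hadj_cen_pv_iff` (= `PHf`) and `hadj_pv_pv_iff` (= `PHin`), each HAdj's three disjuncts rewritten
plus ONE finite check (`phf_raw`, `phin_raw`); the avoided sets `Xset` with their membership tables
(`nx`, `inX`, `pinX`); then the branch form of the contraction lemma: a branch excursion is a hub, or a
pair with at most one in-branch step (`inBranch_hv_end`, `inBranch_pv_end`), so the excursions are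
the branch detour facts (`detour_iff`) and H-connectivity between centrals is `reach4` of `cellMat`
(`relB_cen_iff`, `hConnAvoid_cen_iff_reach4`).
-/

namespace PercRepro.PurePairGraph

open MultiGraph StarGadgetGraph

variable {p q r s n : ℕ}

set_option synthInstance.maxSize 4096 in
/-- The raw H-adjacency formula of a central to a pair vertex is `PHf` (a finite check). -/
theorem phf_raw (μ : Mode) (i : Fin 4) (s : Fin 5 → Bool) (w : Bool) :
    ((i = 2 ∨ i = 3 ∧ μ = some 2) ∧ pinCl μ 2 s w ∧
        (i = 3 ∧ ¬ pxo s w ∨ ∃ m : Fin 3, i = m.castSucc ∧ m = 2 ∧ ¬ pco s w)) ∨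
      ((i = 2 ∨ i = 3 ∧ μ = some 2 ↔ ¬ pinCl μ 2 s w) ∧ (i = 3 ∨ ∃ m : Fin 3, i = m.castSucc ∧ m = 2)) ∨
        (¬ (i = 2 ∨ i = 3 ∧ μ = some 2) ∧ ¬ pinCl μ 2 s w ∧
          (i = 3 ∧ (xatt s w ∨ μ = some 2 ∧ catt s w) ∨ ∃ m : Fin 3, i = m.castSucc ∧ pinCl μ m s w)) ↔
      PHf μ i s w := by
  decide +revert +kernel

/-- **Central–pair H-adjacency** is the pair profile formula `PHf`. -/
theorem hadj_cen_pv_iff {μ : Mode} {ω : Config (PE p q r s n)} (hμ : InMode μ ω) (i : Fin 4)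
    (j : Fin n) (w : Bool) :
    (purePairGadget p q r s n).HAdj ω (vm 2) (cen i) (pv j w) ↔ PHf μ i (pairState ω j) w := by
  unfold HAdj
  rw [cen_mem_M_iff hμ, pv_mem_cluster_vm_iff hμ 2]
  have e1 : (∃ e, ω e = false ∧ (purePairGadget p q r s n).Joins e (cen i) (pv j w)) ↔
      (i = 3 ∧ ¬ pxo (pairState ω j) w) ∨ ∃ m : Fin 3, i = m.castSucc ∧ m = 2 ∧ ¬ pco (pairState ω j) w := by
    rcases cen_cases i with ⟨m, rfl⟩ | rfl
    · rw [cen_castSucc, exists_joins_vm_pv_iff]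
      have h1 : ∀ m : Fin 3, (m.castSucc : Fin 4) ≠ 3 := by decide
      have hc : ω (Sum.inr ⟨Sum.inr j, (if w then 4 else 3 : Fin 5)⟩) = false ↔
          ¬ pco (pairState ω j) w := by
        show ω (Sum.inr ⟨Sum.inr j, (if w then 4 else 3 : Fin 5)⟩) = false ↔
          ¬ ω (Sum.inr ⟨Sum.inr j, (if w then 4 else 3 : Fin 5)⟩) = true
        cases ω (Sum.inr ⟨Sum.inr j, (if w then 4 else 3 : Fin 5)⟩) <;> simp
      have h2 : ∀ m : Fin 3, (m.castSucc : Fin 4) = 2 ↔ m = 2 := by decide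
      rw [hc]
      simp [h1, h2]
    · rw [cen_last, exists_joins_vx_pv_iff]
      have h1 : ∀ m : Fin 3, (3 : Fin 4) ≠ m.castSucc := by decide
      simp only [h1, false_and, exists_false, or_false, true_and]
      show ω (Sum.inr ⟨Sum.inr j, (if w then 2 else 1 : Fin 5)⟩) = false ↔
        ¬ ω (Sum.inr ⟨Sum.inr j, (if w then 2 else 1 : Fin 5)⟩) = true
      cases ω (Sum.inr ⟨Sum.inr j, (if w then 2 else 1 : Fin 5)⟩) <;> simp
  have e2 : (∃ e, (purePairGadget p q r s n).Joins e (cen i) (pv j w)) ↔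
      i = 3 ∨ ∃ m : Fin 3, i = m.castSucc ∧ m = 2 := by
    rcases cen_cases i with ⟨m, rfl⟩ | rfl
    · rw [cen_castSucc]
      have := exists_joins_vm_pv_iff (p := p) (q := q) (r := r) (s := s) (n := n)
        (fun _ => True) m j w
      simp only [true_and, and_true] at this
      rw [this]
      have h1 : ∀ m : Fin 3, (m.castSucc : Fin 4) ≠ 3 := by decide
      have h2 : ∀ m : Fin 3, (m.castSucc : Fin 4) = 2 ↔ m = 2 := by decide
      simp [h1, h2]
    · rw [cen_last]
      have := exists_joins_vx_pv_iff (p := p) (q := q) (r := r) (s := s) (n := n)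
        (fun _ => True) j w
      simp only [true_and] at this
      rw [this]
      simp
  have e3 : (purePairGadget p q r s n).Conn ω (cen i) (pv j w) ↔
      (i = 3 ∧ (xatt (pairState ω j) w ∨ μ = some 2 ∧ catt (pairState ω j) w)) ∨
        ∃ m : Fin 3, i = m.castSucc ∧ pinCl μ m (pairState ω j) w := by
    rcases cen_cases i with ⟨m, rfl⟩ | rfl
    · rw [cen_castSucc, ← mem_cluster, pv_mem_cluster_vm_iff hμ]
      have h1 : ∀ m : Fin 3, (m.castSucc : Fin 4) ≠ 3 := by decide
      simp [h1, Fin.castSucc_inj]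
    · rw [cen_last, ← mem_cluster, pv_mem_cluster_vx_iff hμ]
      have h1 : ∀ m : Fin 3, (3 : Fin 4) ≠ m.castSucc := by decide
      simp [h1]
  rw [e1, e2, e3]
  exact phf_raw μ i (pairState ω j) w

set_option synthInstance.maxSize 4096 in
/-- The raw in-branch H-step formula of a pair is `PHin` (a finite check). -/
theorem phin_raw (μ : Mode) (s : Fin 5 → Bool) :
    ((pinCl μ 2 s false ∧ pinCl μ 2 s true ∧ ¬ puv s) ∨
      ((pinCl μ 2 s false ↔ ¬ pinCl μ 2 s true) ∧ True) ∨
        (¬ pinCl μ 2 s false ∧ ¬ pinCl μ 2 s true ∧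
          (puv s ∨ (pinCl μ 2 s false ∧ pinCl μ 2 s true) ∨ (xatt s false ∧ xatt s true)))) ↔
      PHin μ s := by
  decide +revert +kernel

/-- **The in-branch H-step of a pair** is `PHin`. -/
theorem hadj_pv_pv_iff {μ : Mode} {ω : Config (PE p q r s n)} (hμ : InMode μ ω) (j : Fin n) :
    (purePairGadget p q r s n).HAdj ω (vm 2) (pv j false) (pv j true) ↔ PHin μ (pairState ω j) := by
  unfold HAdj
  rw [pv_mem_cluster_vm_iff hμ 2, pv_mem_cluster_vm_iff hμ 2, conn_pv_pv_iff hμ]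
  have e1 : (∃ e, ω e = false ∧ (purePairGadget p q r s n).Joins e (pv j false) (pv j true)) ↔
      ¬ puv (pairState ω j) := by
    rw [exists_joins_pv_pv_iff]
    show ω (Sum.inr ⟨Sum.inr j, (0 : Fin 5)⟩) = false ↔ ¬ ω (Sum.inr ⟨Sum.inr j, (0 : Fin 5)⟩) = true
    cases ω (Sum.inr ⟨Sum.inr j, (0 : Fin 5)⟩) <;> simp
  have e2 : (∃ e, (purePairGadget p q r s n).Joins e (pv j false) (pv j true)) ↔ True := by
    have := exists_joins_pv_pv_iff (p := p) (q := q) (r := r) (s := s) (n := n) (fun _ => True) j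
    simp only [true_and] at this
    rw [this]
  rw [e1, e2]
  exact phin_raw μ (pairState ω j)

/-! ### The avoided sets -/

/-- The avoided vertex set: nothing, or the open cluster of the mark `m`. -/
def Xset (ω : Config (PE p q r s n)) : Option (Fin 3) → Set (PV p q r s n)
  | none => ∅
  | some m => (purePairGadget p q r s n).cluster ω (vm m)

/-- A central avoids `X` iff `nx` says so. -/
theorem cen_not_mem_Xset_iff {μ : Mode} {ω : Config (PE p q r s n)} (hμ : InMode μ ω)
    (X : Option (Fin 3)) (i : Fin 4) : (cen i : PV p q r s n) ∉ Xset ω X ↔ nx X μ i = true := by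
  rcases X with _ | m
  · simp [Xset, nx]
  · simp only [Xset, nx, Option.some.injEq, forall_eq', decide_eq_true_eq]
    rcases cen_cases i with ⟨m', rfl⟩ | rfl
    · rw [cen_castSucc, vm_mem_cluster_vm_iff hμ.1]
      have h1 : ∀ m : Fin 3, (m.castSucc : Fin 4) ≠ 3 := by decide
      simp [h1, Fin.castSucc_inj]
    · rw [cen_last, vx_mem_cluster_vm_iff' hμ]
      have h1 : ∀ m : Fin 3, (3 : Fin 4) ≠ m.castSucc := by decide
      simp [h1]

/-- A hub vertex avoids `X` iff `inX` fails. -/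
theorem hv_not_mem_Xset_iff {μ : Mode} {ω : Config (PE p q r s n)} (hμ : InMode μ ω)
    (X : Option (Fin 3)) (h : Hub p q r s) :
    (hv h : PV p q r s n) ∉ Xset ω X ↔ ¬ inX μ X (hubType h) (hubState ω h) := by
  rcases X with _ | m
  · simp [Xset, inX]
  · simp only [Xset, inX, Option.some.injEq, exists_eq_left']
    rw [hv_mem_cluster_vm_iff hμ]

/-- A pair vertex avoids `X` iff `pinX` fails. -/
theorem pv_not_mem_Xset_iff {μ : Mode} {ω : Config (PE p q r s n)} (hμ : InMode μ ω)
    (X : Option (Fin 3)) (j : Fin n) (w : Bool) :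
    (pv j w : PV p q r s n) ∉ Xset ω X ↔ ¬ pinX μ X (pairState ω j) w := by
  rcases X with _ | m
  · simp [Xset, pinX]
  · simp only [Xset, pinX, Option.some.injEq, exists_eq_left']
    rw [pv_mem_cluster_vm_iff hμ]

/-- `Xset` is a union of open clusters: closed under connectivity. -/
theorem xset_closed (ω : Config (PE p q r s n)) (X : Option (Fin 3)) :
    ∀ u v, u ∉ Xset ω X → (purePairGadget p q r s n).Conn ω u v → v ∉ Xset ω X := by
  rcases X with _ | m
  · simp [Xset]
  · intro u v hu huv hv
    exact hu ((hv : (purePairGadget p q r s n).Conn ω (vm m) v).trans huv.symm)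

/-- H-connectivity is H-connectivity avoiding nothing. -/
theorem hConn_iff_hConnAvoid_empty (ω : Config (PE p q r s n)) (u v : PV p q r s n) :
    (purePairGadget p q r s n).HConn ω (vm 2) u v ↔
      (purePairGadget p q r s n).HConnAvoid ω (vm 2) (Xset ω none) u v := by
  unfold HConn HConnAvoid
  constructor
  · intro h
    induction h with
    | refl => exact Relation.ReflTransGen.refl
    | tail _ hxy ih => exact ih.tail ⟨hxy, Set.notMem_empty _, Set.notMem_empty _⟩
  · intro h
    induction h with
    | refl => exact Relation.ReflTransGen.refl
    | tail _ hxy ih => exact ih.tail hxy.1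

/-- The vertices of the branch of a hub: the hub vertex. -/
theorem eq_hv_of_br {v : PV p q r s n} {h : Hub p q r s} (hb : br v = some (Sum.inl h)) : v = hv h := by
  rcases vertex_cases v with ⟨i, rfl⟩ | ⟨h', rfl⟩ | ⟨j, w, rfl⟩
  · cases hb
  · rw [br_hv] at hb
    obtain rfl := Sum.inl.inj (Option.some.inj hb)
    rfl
  · rw [br_pv] at hb
    cases Option.some.inj hb

/-- The vertices of the branch of a pair: its two vertices. -/
theorem eq_pv_of_br {v : PV p q r s n} {j : Fin n} (hb : br v = some (Sum.inr j)) : ∃ w, v = pv j w := by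
  rcases vertex_cases v with ⟨i, rfl⟩ | ⟨h', rfl⟩ | ⟨j', w, rfl⟩
  · cases hb
  · rw [br_hv] at hb
    cases Option.some.inj hb
  · rw [br_pv] at hb
    obtain rfl := Sum.inr.inj (Option.some.inj hb)
    exact ⟨w, rfl⟩

/-- An in-branch walk from a hub vertex stays there. -/
theorem inBranch_hv_end {ω : Config (PE p q r s n)} {X : Set (PV p q r s n)} {h : Hub p q r s}
    {b₂ : PV p q r s n}
    (hw : Relation.ReflTransGen ((purePairGadget p q r s n).InBranch ω (vm 2) (Cen p q r s n) X br
      (br (hv h))) (hv h) b₂) : b₂ = hv h := by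
  induction hw with
  | refl => rfl
  | tail _ hxy ih =>
    rw [br_hv] at hxy
    exact eq_hv_of_br hxy.2.2.2.2.1

/-- An in-branch walk from a pair vertex ends at it, or at its partner after one in-branch step. -/
theorem inBranch_pv_end {ω : Config (PE p q r s n)} {X : Set (PV p q r s n)} {j : Fin n} {w : Bool}
    {b₂ : PV p q r s n}
    (hw : Relation.ReflTransGen ((purePairGadget p q r s n).InBranch ω (vm 2) (Cen p q r s n) X br
      (br (pv j w))) (pv j w) b₂) :
    b₂ = pv j w ∨ (b₂ = pv j (!w) ∧
      (purePairGadget p q r s n).InBranch ω (vm 2) (Cen p q r s n) X br (br (pv j w)) (pv j w) (pv j (!w))) := by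
  induction hw with
  | refl => exact Or.inl rfl
  | @tail y z _ hyz ih =>
    have hz : ∃ w', z = pv j w' := by
      rw [br_pv] at hyz
      exact eq_pv_of_br hyz.2.2.2.2.1
    obtain ⟨w', rfl⟩ := hz
    rcases ih with rfl | ⟨rfl, hstep⟩
    · by_cases hww : w' = w
      · subst hww; exact Or.inl rfl
      · have : w' = !w := by cases w <;> cases w' <;> simp_all
        subst this
        exact Or.inr ⟨rfl, hyz⟩
    · by_cases hww : w' = w
      · subst hww; exact Or.inl rfl
      · have : w' = !w := by cases w <;> cases w' <;> simp_all
        subst this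
        exact Or.inr ⟨rfl, hstep⟩

/-- **The branch detours between two centrals are the branch detour facts.** -/
theorem detour_iff {μ : Mode} {ω : Config (PE p q r s n)} (hμ : InMode μ ω) (X : Option (Fin 3))
    (i j : Fin 4) :
    (∃ b₁ b₂, b₁ ∉ Cen p q r s n ∧ b₁ ∉ Xset ω X ∧
      (purePairGadget p q r s n).HAdj ω (vm 2) (cen i) b₁ ∧
      Relation.ReflTransGen ((purePairGadget p q r s n).InBranch ω (vm 2) (Cen p q r s n) (Xset ω X)
        br (br b₁)) b₁ b₂ ∧ (purePairGadget p q r s n).HAdj ω (vm 2) b₂ (cen j)) ↔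
      ∃ b : Br p q r s n, bDpred μ X i j (brType b)
        (fun e => ω (.inr ⟨b, e⟩)) := by
  constructor
  · rintro ⟨b₁, b₂, hC, hX, h1, hw, h2⟩
    rcases vertex_cases b₁ with ⟨i', rfl⟩ | ⟨h, rfl⟩ | ⟨j', w, rfl⟩
    · exact absurd (cen_mem_cen i') hC
    · obtain rfl := inBranch_hv_end hw
      refine ⟨Sum.inl h, (hv_not_mem_Xset_iff hμ X h).1 hX, (hadj_cen_hv_iff hμ i h).1 h1, ?_⟩
      exact (hadj_cen_hv_iff hμ j h).1 h2.symm
    · refine ⟨Sum.inr j', w, (pv_not_mem_Xset_iff hμ X j' w).1 hX, (hadj_cen_pv_iff hμ i j' w).1 h1, ?_⟩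
      rcases inBranch_pv_end hw with rfl | ⟨rfl, hstep⟩
      · exact Or.inl ((hadj_cen_pv_iff hμ j j' w).1 h2.symm)
      · refine Or.inr ⟨(pv_not_mem_Xset_iff hμ X j' (!w)).1 hstep.2.2.2.2.2.2, ?_,
          (hadj_cen_pv_iff hμ j j' (!w)).1 h2.symm⟩
        have hadj := hstep.1
        cases w
        · exact (hadj_pv_pv_iff hμ j').1 hadj
        · exact (hadj_pv_pv_iff hμ j').1 hadj.symm
  · rintro ⟨b, hb⟩
    rcases b with h | j'
    · obtain ⟨hX, h1, h2⟩ := hb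
      refine ⟨hv h, hv h, ?_, (hv_not_mem_Xset_iff hμ X h).2 hX,
        (hadj_cen_hv_iff hμ i h).2 h1, Relation.ReflTransGen.refl, ((hadj_cen_hv_iff hμ j h).2 h2).symm⟩
      rintro ⟨k, hk⟩; cases hk
    · obtain ⟨w, hX, h1, h2⟩ := hb
      have hC : (pv j' w : PV p q r s n) ∉ Cen p q r s n := by rintro ⟨k, hk⟩; cases hk
      rcases h2 with h2 | ⟨hX', hin, h2⟩
      · exact ⟨pv j' w, pv j' w, hC, (pv_not_mem_Xset_iff hμ X j' w).2 hX,
          (hadj_cen_pv_iff hμ i j' w).2 h1, Relation.ReflTransGen.refl,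
          ((hadj_cen_pv_iff hμ j j' w).2 h2).symm⟩
      · have hC' : (pv j' (!w) : PV p q r s n) ∉ Cen p q r s n := by rintro ⟨k, hk⟩; cases hk
        have hadj : (purePairGadget p q r s n).HAdj ω (vm 2) (pv j' w) (pv j' (!w)) := by
          cases w
          · exact (hadj_pv_pv_iff hμ j').2 hin
          · exact ((hadj_pv_pv_iff hμ j').2 hin).symm
        refine ⟨pv j' w, pv j' (!w), hC, (pv_not_mem_Xset_iff hμ X j' w).2 hX,
          (hadj_cen_pv_iff hμ i j' w).2 h1, Relation.ReflTransGen.single ?_,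
          ((hadj_cen_pv_iff hμ j j' (!w)).2 h2).symm⟩
        exact ⟨hadj, hC, hC', rfl, by rw [br_pv, br_pv], (pv_not_mem_Xset_iff hμ X j' w).2 hX,
          (pv_not_mem_Xset_iff hμ X j' (!w)).2 hX'⟩

/-- **A contracted step between two distinct centrals is an entry of `cellMat`**, given the branch
detour facts `d` of the live pairs. -/
theorem relB_cen_iff {μ : Mode} {ω : Config (PE p q r s n)} (hμ : InMode μ ω) {β : Bool}
    (hβ : cxOpen ω ↔ β = true) (X : Option (Fin 3)) (d : Fin 4 → Fin 4 → Bool)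
    (hd : ∀ i j, i ≠ j → nx X μ i = true → nx X μ j = true → T2 true β μ i j = false →
      ((∃ b : Br p q r s n, bDpred μ X i j (brType b) (fun e => ω (.inr ⟨b, e⟩))) ↔ d i j = true))
    (i j : Fin 4) (hij : i ≠ j) :
    (purePairGadget p q r s n).RelB ω (vm 2) (Cen p q r s n) (Xset ω X) br (cen i) (cen j) ↔
      cellMat true β μ X d i j = true := by
  unfold RelB cellMat
  simp only [cen_mem_cen, true_and, cen_not_mem_Xset_iff hμ, hadj_cen_cen_iff hμ hβ i j hij,
    Bool.and_eq_true, Bool.or_eq_true]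
  rw [detour_iff hμ X i j]
  by_cases hi : nx X μ i = true
  · by_cases hj : nx X μ j = true
    · simp only [hi, hj, true_and]
      by_cases hT : T2 true β μ i j = true
      · simp [hT]
      · have hT' : T2 true β μ i j = false := by simpa using hT
        rw [hd i j hij hi hj hT']
    · simp [hj]
  · simp [hi]

/-- **H-connectivity between centrals is `reach4` of `cellMat`.** -/
theorem hConnAvoid_cen_iff_reach4 {μ : Mode} {ω : Config (PE p q r s n)} (hμ : InMode μ ω)
    {β : Bool} (hβ : cxOpen ω ↔ β = true) (X : Option (Fin 3)) (d : Fin 4 → Fin 4 → Bool)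
    (hd : ∀ i j, i ≠ j → nx X μ i = true → nx X μ j = true → T2 true β μ i j = false →
      ((∃ b : Br p q r s n, bDpred μ X i j (brType b) (fun e => ω (.inr ⟨b, e⟩))) ↔ d i j = true))
    (i j : Fin 4) :
    (purePairGadget p q r s n).HConnAvoid ω (vm 2) (Xset ω X) (cen i) (cen j) ↔
      reach4 (cellMat true β μ X d) i j := by
  rw [(purePairGadget p q r s n).hConnAvoid_iff_relB ω (vm 2) (Cen p q r s n) (Xset ω X) br
    cover (xset_closed ω X) (cen_mem_cen i) (cen_mem_cen j)]
  rw [reflTransGen_comap_iff cen cen_injective _ (fun x y hxy => ⟨hxy.1, hxy.2.1⟩)]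
  rw [reflTransGen_iff_reachable_fromRel (fun _ _ hxy => RelB.symm hxy)]
  unfold reach4
  have hG : SimpleGraph.fromRel (fun i j : Fin 4 =>
      (purePairGadget p q r s n).RelB ω (vm 2) (Cen p q r s n) (Xset ω X) br (cen i) (cen j)) =
      SimpleGraph.fromRel fun i j => cellMat true β μ X d i j = true := by
    ext i j
    simp only [SimpleGraph.fromRel_adj]
    constructor
    · rintro ⟨hij, h | h⟩
      · exact ⟨hij, Or.inl ((relB_cen_iff hμ hβ X d hd i j hij).1 h)⟩
      · exact ⟨hij, Or.inr ((relB_cen_iff hμ hβ X d hd j i (Ne.symm hij)).1 h)⟩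
    · rintro ⟨hij, h | h⟩
      · exact ⟨hij, Or.inl ((relB_cen_iff hμ hβ X d hd i j hij).2 h)⟩
      · exact ⟨hij, Or.inr ((relB_cen_iff hμ hβ X d hd j i (Ne.symm hij)).2 h)⟩
  rw [hG]

end PercRepro.PurePairGraph

namespace PercRepro.PurePairGraph

open Finset StarGadgetGraph

variable {p q r s n : ℕ}

end PercRepro.PurePairGraph
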